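import Literature.MathematicalPhysics.QuantumFieldTheory.Balaban1983to89.B4Thm112BoxValue

/-!
# `Balaban1983to89.B4Thm112BoxDeriv` — [Balaban1983RegularityDecay] THEOREM p. 573, the `δG` clause (1.11)–(1.12),
# DERIVATIVE MEMBER, ON EVERY NESTED PAIR OF BOXES `Ω ⊂ Ω₀`, FOR A (1.7)-REGULAR FIELD, WITH ONLY «e SUFFICIENTLY
# SMALL»: `|(D^η_{A,ν}δG_k(Ω,Ω₀,A)f)(x)| ≤ c₁·exp(−(2K)⁻¹(dist(x,supp f) + dist(x,Ω₀∖Ω) + dist(supp f,Ω₀∖Ω)))·‖f‖_∞`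
# on every bond `⟨x, x+ηe_ν⟩ ⊂ Ω`; with the reusable annular machinery of the cutoff–commutator route

statement-level skeleton of published theorems with citation tags; proofs where landed; nothing here is a claim about the Yang–Mills mass gap

CITATION HEADER.  T. Bałaban, *Regularity and decay of lattice Green's functions*, Commun. Math. Phys. **89** (1983)
571–597, doi:10.1007/bf01214744 [Balaban1983RegularityDecay] (cell paper B4; held text
`paper:balaban1983-cmp89-regularity-decay`, journal page = PDF page + 570; p. 573 Theorem (1.10)–(1.12), p. 579).
Unit `lit-balaban-p17` gen 5 (Phase-2 proof seat p17; HOME `run/shared/lean/pub/lit-balaban/`), SKELETON row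
**B4.Thm@573** (clause (1.11)–(1.12), derivative member, rectangular `Ω ⊂ Ω₀`).  Imports p17 g5 `B4Thm112BoxValue`
(the value member and the bridges to the zero-field leaf's cutoff `χ`: `hsize_chi`, `exists_out_of_chi_ne_one`,
`chi_eq_zero_of_layer`, `kOp_chi_apply_le`, `exists_out_of_kOp_ne_zero`, the distance utilities; → p17 g5
`B4Thm112BoxIdentity`: `extV`, `deltaG_decomp`; → `B4Thm110BoxUniform`, `B4Thm110BoxDerivUniform`).

WHAT IS PRINTED (p. 573).  «If Ω ⊂ Ω₀, then for δG_k(Ω, Ω₀, A) … we have the inequalities (1.9) and (1.10) (with the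
same restrictions on x, x′) with the additional factor exp(−δ₀ dist(supp f, Ω^c) − δ₀ dist(supp f, Ω^c)) (1.12)»;
(1.10): «|(D^η_{A,μ}G_k(Ω,A)f)(x)|, |(G_k(Ω,A)f)(x)| ≤ c₀ exp(−δ₀ dist(x, supp f))‖f‖_∞».

WHAT THIS MODULE PROVES (all in full; `n = (ℓ+1)^k`, `Ω₀ = Box d ℓ k Mb`, `Ω = n·o + Box d ℓ k Ms`).
* §1 `restrV` (restriction of a field on `Ω₀` to `Ω`) and `derivA_restrV_apply`: on a bond of `Ω` the covariant
  derivative of `Ω` of a restricted field is the covariant derivative of `Ω₀` (same link variable);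
  `derivA_mulH_apply`: the Leibniz rule `D_ν(hΦ)(x) = h(x+e_ν)(D_νΦ)(x) + n(h(x+e_ν) − h(x))Φ(x)`;
  `deltaG_decomp_fun`: `B4Thm112BoxIdentity.deltaG_decomp` as an identity of fields on `Ω`.
* §2 THE ANNULAR MACHINERY of the cutoff–commutator route, abstracted for reuse by every member: `mIdx`/`annPiece`
  (the unit annuli around `x` and the pieces of a source), `mIdx_mul_le`, `lt_mIdx_add_one_mul`, `mIdx_lt`,
  `extV_eq_sum_annPiece`; **`source_facts`** (size `C·e^{−R_m/K}·φ`, support in the annulus, and vanishing for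
  `m + 3 ≤ D_b`, of the pieces of the commutator source `E(K_χu)`, from bounds on `u` and `D^ηu` within one unit);
  **`annular_bound`** (for any additive functional `R` of the source with a row bound of rate `K⁻¹` from the point
  `x`: `|R(E(K_χu))| ≤ c_R·C·e^{4/K}(1 − e^{−1/(2K)})⁻¹·e^{−(D+D_b+D_f)/(2K)}·φ` — the print's bookkeeping
  «(2M)⁻¹(dist + dist + dist) − 3» as a geometric series in the annulus index).
* §3 **`thm112_deriv_box_uniform`** — THE DERIVATIVE MEMBER OF (1.10)·(1.12) FOR `δG_k(Ω,Ω₀,A)` ON NESTED BOXES,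
  HYPOTHESIS-FREE AND UNIFORM: `∃ K (16 ≤ K, 4 ∣ K) ∃ c₁ > 0 ∀ (c,β) ∃ e₁ > 0` such that for every scale, pair of boxes
  (unit sides multiples of `K`), (1.7)-regular `A_c` constant on the `K`-collars of `Ω₀` and `Ω`, `0 < e ≤ e₁`, bond
  `⟨x, x+e_ν⟩ ⊂ Ω`, source `f` on `Ω` (`|f| ≤ φ`, supported in `P`) and `D, D_b, D_f ≥ 0` below the unit-lattice
  sup-distances `x ↔ P`, `x ↔ Ω₀∖Ω`, `P ↔ Ω₀∖Ω`:
  `|(D^η_{A,ν}G_k(Ω,A|Ω)f)(x)_i − (D^η_{A,ν}G_k(Ω₀,A)Ef)(x)_i| ≤ c₁·exp(−(D + D_b + D_f)/(2K))·φ`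
  (the left side IS `D^η_{A,ν}` of `δG f` on the bond, `derivA_restrV_apply`).
HONEST SCOPE.  As `B4Thm112BoxValue` (route: cutoff–commutator identity, not the print's walk cancellation; boxes with
sides multiples of `K`; `A` constant on both `K`-collars, G-B4-p17-02; `d ≥ 1`; distances to `Ω₀∖Ω ⊆ Ω^c`; rate
`(2K)⁻¹`).  Derivative member only (Hölder member: sequel).  No `sorry`; no new `Prop` fact; axioms standard.
-/

namespace Literature.MathematicalPhysics.QuantumFieldTheory.Balaban1983to89.B4Thm112BoxDeriv

open Literature.MathematicalPhysics.QuantumFieldTheory.Balaban1983to89.B4Reflection242 (boxDom mem_boxDom nbrs mem_nbrs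
  nbrs_comm blk)
open Literature.MathematicalPhysics.QuantumFieldTheory.Balaban1983to89.B4GaugeCovariance
open Literature.MathematicalPhysics.QuantumFieldTheory.Balaban1983to89.B4Commutators25to211 (mulH opK fld_mulH_mulVec)
open Literature.MathematicalPhysics.QuantumFieldTheory.Balaban1983to89.B4ContourShift (supNorm supNorm_nonneg
  exists_supNorm_eq abs_le_supNorm)
open Literature.MathematicalPhysics.QuantumFieldTheory.Balaban1983to89.B4Lower18 (supNorm_sub_le_one_of_mem_nbrs)
open Literature.MathematicalPhysics.QuantumFieldTheory.Balaban1983to89.B4Lower18Regular (e1 baseEmb stairContour)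
open Literature.MathematicalPhysics.QuantumFieldTheory.Balaban1983to89.B4Lower18RegularRegion (compField)
open Literature.MathematicalPhysics.QuantumFieldTheory.Balaban1983to89.B4Lemma21Region (siteNorm covDeriv
  fld_covDeriv_mulVec_of_mem)
open Literature.MathematicalPhysics.QuantumFieldTheory.Balaban1983to89.B4Lemma22ReduceZero (Box opA greenA derivA)
open Literature.MathematicalPhysics.QuantumFieldTheory.Balaban1983to89.B4Eq220CommutatorZeroBox (HSize)
open Literature.MathematicalPhysics.QuantumFieldTheory.Balaban1983to89.B4Eq220CommutatorField (kOp)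
open Literature.MathematicalPhysics.QuantumFieldTheory.Balaban1983to89.B4Ineq110WalkRoute (mulH_mulVec_apply)
open Literature.MathematicalPhysics.QuantumFieldTheory.Balaban1983to89.B4Green242Bridge (boxNbrs boxBlk)
open Literature.MathematicalPhysics.QuantumFieldTheory.Balaban1983to89.B4Delta112ZeroBox (chi two_le_pow)
open Literature.MathematicalPhysics.QuantumFieldTheory.Balaban1983to89.B4Thm110ZeroBox (supNorm_sub_le_sub_add_sub)
open Literature.MathematicalPhysics.QuantumFieldTheory.Balaban1983to89.B4TwoRegion120 (supNorm_sub_comm)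
open Literature.MathematicalPhysics.QuantumFieldTheory.Balaban1983to89.B4SubBoxCarrier (subEmb inSub inSub_iff
  subEmb_injective)
open Literature.MathematicalPhysics.QuantumFieldTheory.Balaban1983to89.B4CubeGreenBox (subField)
open Literature.MathematicalPhysics.QuantumFieldTheory.Balaban1983to89.B4BoxCubeGeometry (posR)
open Literature.MathematicalPhysics.QuantumFieldTheory.Balaban1983to89.B4RegionCubeCarrier (compField_add)
open Literature.MathematicalPhysics.QuantumFieldTheory.Balaban1983to89.B4Thm110BoxUniform (thm110_value_box_uniform)
open Literature.MathematicalPhysics.QuantumFieldTheory.Balaban1983to89.B4Thm110BoxDerivUniform (thm110_deriv_box_uniform)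
open Literature.MathematicalPhysics.QuantumFieldTheory.Balaban1983to89.B4Thm112BoxIdentity (extV extV_subEmb
  extV_of_not_inSub Layer deltaG_decomp)
open Literature.MathematicalPhysics.QuantumFieldTheory.Balaban1983to89.B4Thm112BoxValue (chi_eq_zero_of_layer
  exists_out_of_chi_ne_one hsize_chi exists_coord_of_le_supNorm le_supNorm_of_coord supNorm_subEmb_sub_subEmb
  supNorm_sub_lt_box exists_out_of_kOp_ne_zero kOp_chi_apply_le max_half_mul_le max3_mul_le exp_bookkeeping)
open scoped Matrix

noncomputable section

variable {d : ℕ}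

/-! ## §1. Restriction to `Ω`, the derivative across the embedding, the Leibniz rule -/

section Restr

variable (ℓ k : ℕ) (Mb Ms o : Fin (d + 1) → ℕ) {ι : Type} [Fintype ι] [DecidableEq ι] (F : OrthFlow ι) (κ : ℝ)

omit [Fintype ι] [DecidableEq ι] in
/-- RESTRICTION of a field on `Ω₀` to `Ω` (reading `G_k(Ω₀,A)Ef` on `Ω`, as `δG_k(Ω,Ω₀,A)f` is).
[cite: Balaban1983RegularityDecay, (1.11) p.573, dictionary] -/
def restrV (ho : ∀ i, o i + Ms i ≤ Mb i) (w : ↥(Box d ℓ k Mb) × ι → ℝ) : ↥(Box d ℓ k Ms) × ι → ℝ :=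
  fun q => w (subEmb ℓ k Mb Ms o ho q.1, q.2)

omit [Fintype ι] [DecidableEq ι] in
/-- the restriction, evaluated. [cite: Balaban1983RegularityDecay, (1.11) p.573, dictionary] -/
@[simp] theorem restrV_apply (ho : ∀ i, o i + Ms i ≤ Mb i) (w : ↥(Box d ℓ k Mb) × ι → ℝ) (q : ↥(Box d ℓ k Ms) × ι) :
    restrV ℓ k Mb Ms o ho w q = w (subEmb ℓ k Mb Ms o ho q.1, q.2) := rfl

/-- the image of the end of a bond of `Ω` is the end of the image bond. [cite: Balaban1983RegularityDecay, (1.3) p.572, dictionary] -/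
theorem subEmb_add_e1 (ho : ∀ i, o i + Ms i ≤ Mb i) (x : ↥(Box d ℓ k Ms)) (ν : Fin (d + 1))
    (hx : x.1 + e1 ν ∈ Box d ℓ k Ms) :
    (subEmb ℓ k Mb Ms o ho x).1 + e1 ν = (subEmb ℓ k Mb Ms o ho ⟨x.1 + e1 ν, hx⟩).1 := by
  funext j
  simp only [subEmb, Pi.add_apply]
  ring

/-- the image bond lies in `Ω₀`. [cite: Balaban1983RegularityDecay, (1.3) p.572, dictionary] -/
theorem subEmb_add_e1_mem (ho : ∀ i, o i + Ms i ≤ Mb i) (x : ↥(Box d ℓ k Ms)) (ν : Fin (d + 1))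
    (hx : x.1 + e1 ν ∈ Box d ℓ k Ms) : (subEmb ℓ k Mb Ms o ho x).1 + e1 ν ∈ Box d ℓ k Mb := by
  rw [subEmb_add_e1 ℓ k Mb Ms o ho x ν hx]
  exact (subEmb ℓ k Mb Ms o ho ⟨x.1 + e1 ν, hx⟩).2

/-- **`D^η_{A|Ω,ν}(w|Ω)(x) = (D^η_{A,ν}w)(x)` ON A BOND `⟨x, x+ηe_ν⟩ ⊂ Ω`**: the covariant derivative of `Ω` of a
restricted field is the restriction of the covariant derivative of `Ω₀` (same link variable `U(A_{⟨x,x+ηe_ν⟩})`).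
[cite: Balaban1983RegularityDecay, (1.3) p.572, (1.11) p.573] -/
theorem derivA_restrV_apply (ho : ∀ i, o i + Ms i ≤ Mb i) (A : ↥(Box d ℓ k Mb) → ↥(Box d ℓ k Mb) → ℝ)
    (w : ↥(Box d ℓ k Mb) × ι → ℝ) (ν : Fin (d + 1)) (x : ↥(Box d ℓ k Ms)) (hx : x.1 + e1 ν ∈ Box d ℓ k Ms)
    (i : ι) :
    (derivA d F κ ℓ k Ms (subField ℓ k Mb Ms o ho A) ν *ᵥ restrV ℓ k Mb Ms o ho w) (x, i)
      = (derivA d F κ ℓ k Mb A ν *ᵥ w) (subEmb ℓ k Mb Ms o ho x, i) := by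
  have hx' := subEmb_add_e1_mem ℓ k Mb Ms o ho x ν hx
  have h1 := congrFun (fld_covDeriv_mulVec_of_mem ((ℓ + 1) ^ k) (fieldLink F κ (subField ℓ k Mb Ms o ho A))
    (μ := ν) (restrV ℓ k Mb Ms o ho w) (x := x) hx) i
  have h2 := congrFun (fld_covDeriv_mulVec_of_mem ((ℓ + 1) ^ k) (fieldLink F κ A) (μ := ν) w
    (x := subEmb ℓ k Mb Ms o ho x) hx') i
  rw [fld_apply] at h1 h2
  rw [derivA, derivA, h1, h2]
  have he : subEmb ℓ k Mb Ms o ho ⟨x.1 + e1 ν, hx⟩ = ⟨(subEmb ℓ k Mb Ms o ho x).1 + e1 ν, hx'⟩ :=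
    Subtype.ext (subEmb_add_e1 ℓ k Mb Ms o ho x ν hx).symm
  have hfld : fld (restrV ℓ k Mb Ms o ho w) ⟨x.1 + e1 ν, hx⟩ = fld w ⟨(subEmb ℓ k Mb Ms o ho x).1 + e1 ν, hx'⟩ := by
    funext j; simp only [fld_apply, restrV_apply, he]
  have hfld0 : fld (restrV ℓ k Mb Ms o ho w) x = fld w (subEmb ℓ k Mb Ms o ho x) := by
    funext j; simp only [fld_apply, restrV_apply]
  have hW : fieldLink F κ (subField ℓ k Mb Ms o ho A) x ⟨x.1 + e1 ν, hx⟩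
      = fieldLink F κ A (subEmb ℓ k Mb Ms o ho x) ⟨(subEmb ℓ k Mb Ms o ho x).1 + e1 ν, hx'⟩ := by
    simp only [fieldLink, subField, he]
  rw [hfld, hfld0, hW]

/-- **THE LEIBNIZ RULE FOR `D^η_{A,ν}`**: `(D^η_{A,ν}(hΦ))(x) = h(x+e_ν)(D^η_{A,ν}Φ)(x) + n(h(x+e_ν) − h(x))Φ(x)` on a
bond of the box (the link variable acts on `Φ`, the scalar `h` commutes with it). [cite: Balaban1983RegularityDecay, (1.3) p.572, (2.10) p.576] -/
theorem derivA_mulH_apply (M : Fin (d + 1) → ℕ) (A : ↥(Box d ℓ k M) → ↥(Box d ℓ k M) → ℝ) (h : ↥(Box d ℓ k M) → ℝ)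
    (Φ : ↥(Box d ℓ k M) × ι → ℝ) (ν : Fin (d + 1)) (x : ↥(Box d ℓ k M)) (hx : x.1 + e1 ν ∈ Box d ℓ k M) (i : ι) :
    (derivA d F κ ℓ k M A ν *ᵥ (mulH (ι := ι) h *ᵥ Φ)) (x, i)
      = h ⟨x.1 + e1 ν, hx⟩ * (derivA d F κ ℓ k M A ν *ᵥ Φ) (x, i)
        + (((ℓ + 1) ^ k : ℕ) : ℝ) * (h ⟨x.1 + e1 ν, hx⟩ - h x) * Φ (x, i) := by
  have h1 := congrFun (fld_covDeriv_mulVec_of_mem ((ℓ + 1) ^ k) (fieldLink F κ A) (μ := ν)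
    (mulH (ι := ι) h *ᵥ Φ) (x := x) hx) i
  have h2 := congrFun (fld_covDeriv_mulVec_of_mem ((ℓ + 1) ^ k) (fieldLink F κ A) (μ := ν) Φ (x := x) hx) i
  rw [fld_apply] at h1 h2
  rw [derivA, h1, h2, fld_mulH_mulVec, fld_mulH_mulVec, Matrix.mulVec_smul]
  simp only [Pi.smul_apply, Pi.sub_apply, smul_eq_mul, fld_apply]
  ring

/-- `B4Thm112BoxIdentity.deltaG_decomp` AS AN IDENTITY OF FIELDS ON `Ω`:
`G_k(Ω)f − (G_k(Ω₀)Ef)|Ω = (1−χ)·G_k(Ω)f − (G_k(Ω₀)E(K_χG_k(Ω)f))|Ω − (G_k(Ω₀)E((1−χ)f))|Ω`.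
[cite: Balaban1983RegularityDecay, (1.11) p.573, p.579] -/
theorem deltaG_decomp_fun (ho : ∀ i, o i + Ms i ≤ Mb i) (hℓ : 1 ≤ ℓ) (hk : 1 ≤ k) (hn : 1 ≤ (ℓ + 1) ^ k)
    {a m2 : ℝ} (ha : 0 < a) (hm : 0 ≤ m2) (A : ↥(Box d ℓ k Mb) → ↥(Box d ℓ k Mb) → ℝ) (χv : ↥(Box d ℓ k Ms) → ℝ)
    (hχ : ∀ z, Layer ℓ k Mb Ms o ho z → χv z = 0) (f : ↥(Box d ℓ k Ms) × ι → ℝ) :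
    greenA d F κ ℓ k a m2 Ms (baseEmb hn Ms) (stairContour hn Ms) (subField ℓ k Mb Ms o ho A) *ᵥ f
      - restrV ℓ k Mb Ms o ho
          (greenA d F κ ℓ k a m2 Mb (baseEmb hn Mb) (stairContour hn Mb) A *ᵥ extV ℓ k Mb Ms o f)
      = mulH (ι := ι) (fun z => 1 - χv z)
          *ᵥ (greenA d F κ ℓ k a m2 Ms (baseEmb hn Ms) (stairContour hn Ms) (subField ℓ k Mb Ms o ho A) *ᵥ f)
        - restrV ℓ k Mb Ms o ho (greenA d F κ ℓ k a m2 Mb (baseEmb hn Mb) (stairContour hn Mb) A *ᵥ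
            extV ℓ k Mb Ms o
              (kOp F κ ((ℓ + 1) ^ k) (B1.aSeq a ((ℓ : ℝ) + 1) k) m2 Ms (baseEmb hn Ms) (stairContour hn Ms)
                  (subField ℓ k Mb Ms o ho A) χv
                *ᵥ (greenA d F κ ℓ k a m2 Ms (baseEmb hn Ms) (stairContour hn Ms) (subField ℓ k Mb Ms o ho A)
                  *ᵥ f)))
        - restrV ℓ k Mb Ms o ho (greenA d F κ ℓ k a m2 Mb (baseEmb hn Mb) (stairContour hn Mb) A *ᵥ
            extV ℓ k Mb Ms o (mulH (ι := ι) (fun z => 1 - χv z) *ᵥ f)) := by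
  funext q
  obtain ⟨x, i⟩ := q
  simp only [Pi.sub_apply, restrV_apply, mulH_mulVec_apply]
  exact deltaG_decomp ℓ k Mb Ms o F κ ho hℓ hk hn ha hm A χv hχ f x i

end Restr

/-! ## §2. The annular machinery of the cutoff–commutator route -/

section Annular

variable (ℓ k : ℕ) (Mb Ms o : Fin (d + 1) → ℕ) {ι : Type} [Fintype ι] [DecidableEq ι] (F : OrthFlow ι) (κ : ℝ)

omit [Fintype ι] [DecidableEq ι] in
/-- THE ANNULUS INDEX of a site `a` of `Ω` seen from `x`: `⌊|x − a|_∞/n⌋` (unit-lattice units).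
[cite: Balaban1983RegularityDecay, p.579 «n ≥ M⁻¹ sup (…) − 3», dictionary] -/
def mIdx (x a : ↥(Box d ℓ k Ms)) : ℕ := ⌊supNorm (x.1 - a.1) / (((ℓ + 1) ^ k : ℕ) : ℝ)⌋₊

omit [Fintype ι] [DecidableEq ι] in
/-- THE PIECE OF A SOURCE on the annulus of index `m` around `x`. [cite: Balaban1983RegularityDecay, p.579, dictionary] -/
def annPiece (x : ↥(Box d ℓ k Ms)) (m : ℕ) (g : ↥(Box d ℓ k Ms) × ι → ℝ) : ↥(Box d ℓ k Ms) × ι → ℝ :=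
  fun q => if mIdx ℓ k Ms x q.1 = m then g q else 0

omit [Fintype ι] [DecidableEq ι] in
/-- `m·n ≤ |x − a|_∞` on the annulus `m`. [cite: Balaban1983RegularityDecay, p.579, dictionary] -/
theorem mIdx_mul_le (x a : ↥(Box d ℓ k Ms)) :
    (mIdx ℓ k Ms x a : ℝ) * (((ℓ + 1) ^ k : ℕ) : ℝ) ≤ supNorm (x.1 - a.1) := by
  have hnr : (0 : ℝ) < (((ℓ + 1) ^ k : ℕ) : ℝ) := by
    have : 1 ≤ (ℓ + 1) ^ k := Nat.one_le_pow _ _ (Nat.succ_pos ℓ)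
    exact_mod_cast this
  have := Nat.floor_le (div_nonneg (supNorm_nonneg (x.1 - a.1)) hnr.le)
  exact (le_div_iff₀ hnr).mp this

omit [Fintype ι] [DecidableEq ι] in
/-- `|x − a|_∞ < (m+1)·n` on the annulus `m`. [cite: Balaban1983RegularityDecay, p.579, dictionary] -/
theorem lt_mIdx_add_one_mul (x a : ↥(Box d ℓ k Ms)) :
    supNorm (x.1 - a.1) < ((mIdx ℓ k Ms x a : ℝ) + 1) * (((ℓ + 1) ^ k : ℕ) : ℝ) := by
  have hnr : (0 : ℝ) < (((ℓ + 1) ^ k : ℕ) : ℝ) := by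
    have : 1 ≤ (ℓ + 1) ^ k := Nat.one_le_pow _ _ (Nat.succ_pos ℓ)
    exact_mod_cast this
  have := Nat.lt_floor_add_one (supNorm (x.1 - a.1) / (((ℓ + 1) ^ k : ℕ) : ℝ))
  exact (div_lt_iff₀ hnr).mp this

omit [Fintype ι] [DecidableEq ι] in
/-- the annulus indices on a box are `< Σ_i Ms_i + 1`. [cite: Balaban1983RegularityDecay, p.579, dictionary] -/
theorem mIdx_lt (x a : ↥(Box d ℓ k Ms)) : mIdx ℓ k Ms x a < (∑ i, Ms i) + 1 := by
  have hnr : (0 : ℝ) < (((ℓ + 1) ^ k : ℕ) : ℝ) := by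
    have : 1 ≤ (ℓ + 1) ^ k := Nat.one_le_pow _ _ (Nat.succ_pos ℓ)
    exact_mod_cast this
  have hnr1 : (1 : ℝ) ≤ (((ℓ + 1) ^ k : ℕ) : ℝ) := by
    have : 1 ≤ (ℓ + 1) ^ k := Nat.one_le_pow _ _ (Nat.succ_pos ℓ)
    exact_mod_cast this
  have h1 := mIdx_mul_le ℓ k Ms x a
  have h2 := supNorm_sub_lt_box ℓ k Ms x a
  have h3 : (mIdx ℓ k Ms x a : ℝ) * (((ℓ + 1) ^ k : ℕ) : ℝ)
      < (((∑ i, Ms i : ℕ) : ℝ) + 1) * (((ℓ + 1) ^ k : ℕ) : ℝ) := by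
    rw [add_mul, one_mul]
    linarith only [h1, h2, hnr1]
  have h4 : (mIdx ℓ k Ms x a : ℝ) < ((∑ i, Ms i : ℕ) : ℝ) + 1 := lt_of_mul_lt_mul_right h3 hnr.le
  exact_mod_cast h4

omit [Fintype ι] [DecidableEq ι] in
/-- **A SOURCE ON `Ω`, EXTENDED BY ZERO, IS THE SUM OF ITS ANNULAR PIECES.**
[cite: Balaban1983RegularityDecay, p.579, dictionary] -/
theorem extV_eq_sum_annPiece (x : ↥(Box d ℓ k Ms)) (g : ↥(Box d ℓ k Ms) × ι → ℝ) :
    extV ℓ k Mb Ms o g = ∑ m ∈ Finset.range ((∑ i, Ms i) + 1), extV ℓ k Mb Ms o (annPiece ℓ k Ms x m g) := by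
  funext q
  rw [Finset.sum_apply]
  by_cases hq : inSub ℓ k Mb Ms o q.1
  · simp only [extV, dif_pos hq, annPiece]
    rw [Finset.sum_ite_eq, if_pos (Finset.mem_range.mpr (mIdx_lt ℓ k Ms x _))]
  · simp only [extV, dif_neg hq, Finset.sum_const_zero]

/-- **THE PIECES OF THE COMMUTATOR SOURCE `E(K_χu)`: SIZE, SUPPORT AND VANISHING.**  If `|u| ≤ c_v e^{−D′/K}φ` and
`|D^η_{A,μ}u| ≤ c_d e^{−D′/K}φ` at every site whose unit-lattice sup-distance to the support `P` of `f` is `≥ D′ ≥ 0`,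
and `D, D_b, D_f` are below the distances `x ↔ P`, `x ↔ Ω₀∖Ω`, `P ↔ Ω₀∖Ω`, then the piece of index `m` of `E(K_χu)`
is bounded by `C·e^{−R_m/K}·φ`, `R_m = max(D − m − 2, D_f − 3, 0)`, `C = |√N(16(d+1)c_d + (64(d+1) + 2a₊)c_v)|`, is
supported over the annulus `m`, and VANISHES when `m + 3 ≤ D_b` (the source lives within two units of `Ω₀ ∖ Ω`).
[cite: Balaban1983RegularityDecay, (2.10) p.576, p.579] -/
theorem source_facts (ho : ∀ i, o i + Ms i ≤ Mb i) (hℓ : 1 ≤ ℓ) (hk : 1 ≤ k) (hn : 1 ≤ (ℓ + 1) ^ k)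
    (hMs : ∀ i, 1 ≤ Ms i) {amin aplus a : ℝ} (ha : 0 < amin) (h1 : amin ≤ a) (h2 : a ≤ aplus) (m2 : ℝ)
    (Ac' : (Fin (d + 1) → ℤ) → Fin (d + 1) → ℝ) (u : ↥(Box d ℓ k Ms) × ι → ℝ) (x : ↥(Box d ℓ k Ms))
    (P : ↥(Box d ℓ k Ms) → Prop) {K cv cd φ D Db Df : ℝ} (hcv : 0 ≤ cv) (hcd : 0 ≤ cd) (hφ : 0 ≤ φ)
    (hDx : ∀ x', P x' → D * (((ℓ + 1) ^ k : ℕ) : ℝ) ≤ supNorm (x.1 - x'.1))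
    (hDbx : ∀ y : ↥(Box d ℓ k Mb), ¬ inSub ℓ k Mb Ms o y →
      Db * (((ℓ + 1) ^ k : ℕ) : ℝ) ≤ supNorm ((subEmb ℓ k Mb Ms o ho x).1 - y.1))
    (hDfx : ∀ x', P x' → ∀ y : ↥(Box d ℓ k Mb), ¬ inSub ℓ k Mb Ms o y →
      Df * (((ℓ + 1) ^ k : ℕ) : ℝ) ≤ supNorm ((subEmb ℓ k Mb Ms o ho x').1 - y.1))
    (hval : ∀ (a'' : ↥(Box d ℓ k Ms)) (D' : ℝ), 0 ≤ D' →
      (∀ x', P x' → D' * (((ℓ + 1) ^ k : ℕ) : ℝ) ≤ supNorm (a''.1 - x'.1)) →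
      ∀ j, |u (a'', j)| ≤ cv * Real.exp (-(D' / K)) * φ)
    (hder : ∀ (a'' : ↥(Box d ℓ k Ms)) (μ : Fin (d + 1)), a''.1 + e1 μ ∈ Box d ℓ k Ms → ∀ (D' : ℝ), 0 ≤ D' →
      (∀ x', P x' → D' * (((ℓ + 1) ^ k : ℕ) : ℝ) ≤ supNorm (a''.1 - x'.1)) →
      ∀ j, |(derivA d F κ ℓ k Ms (fun u v : ↥(Box d ℓ k Ms) => compField Ac' u.1 v.1) μ *ᵥ u) (a'', j)|
        ≤ cd * Real.exp (-(D' / K)) * φ)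
    (m : ℕ) (q : ↥(Box d ℓ k Mb) × ι) :
    |extV ℓ k Mb Ms o (annPiece ℓ k Ms x m
        (kOp F κ ((ℓ + 1) ^ k) (B1.aSeq a ((ℓ : ℝ) + 1) k) m2 Ms (baseEmb hn Ms) (stairContour hn Ms)
          (fun u v : ↥(Box d ℓ k Ms) => compField Ac' u.1 v.1)
          (fun z => chi ((ℓ + 1) ^ k) Ms Mb (fun i => (o i : ℤ)) z.1) *ᵥ u)) q|
      ≤ |Real.sqrt (Fintype.card ι) * (16 * ((d : ℝ) + 1) * cd + (64 * ((d : ℝ) + 1) + 2 * aplus) * cv)|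
        * Real.exp (-(max (max (D - m - 2) (Df - 3)) 0 / K)) * φ ∧
    (((m : ℝ) + 3 ≤ Db) → extV ℓ k Mb Ms o (annPiece ℓ k Ms x m
        (kOp F κ ((ℓ + 1) ^ k) (B1.aSeq a ((ℓ : ℝ) + 1) k) m2 Ms (baseEmb hn Ms) (stairContour hn Ms)
          (fun u v : ↥(Box d ℓ k Ms) => compField Ac' u.1 v.1)
          (fun z => chi ((ℓ + 1) ^ k) Ms Mb (fun i => (o i : ℤ)) z.1) *ᵥ u)) q = 0) ∧
    (extV ℓ k Mb Ms o (annPiece ℓ k Ms x m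
        (kOp F κ ((ℓ + 1) ^ k) (B1.aSeq a ((ℓ : ℝ) + 1) k) m2 Ms (baseEmb hn Ms) (stairContour hn Ms)
          (fun u v : ↥(Box d ℓ k Ms) => compField Ac' u.1 v.1)
          (fun z => chi ((ℓ + 1) ^ k) Ms Mb (fun i => (o i : ℤ)) z.1) *ᵥ u)) q ≠ 0 →
      ∃ a', subEmb ℓ k Mb Ms o ho a' = q.1 ∧ mIdx ℓ k Ms x a' = m) := by
  set g := kOp F κ ((ℓ + 1) ^ k) (B1.aSeq a ((ℓ : ℝ) + 1) k) m2 Ms (baseEmb hn Ms) (stairContour hn Ms)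
    (fun u v : ↥(Box d ℓ k Ms) => compField Ac' u.1 v.1)
    (fun z => chi ((ℓ + 1) ^ k) Ms Mb (fun i => (o i : ℤ)) z.1) *ᵥ u with hg
  clear_value g
  set CK : ℝ := Real.sqrt (Fintype.card ι) * (16 * ((d : ℝ) + 1) * cd + (64 * ((d : ℝ) + 1) + 2 * aplus) * cv)
    with hCK
  set Rm : ℝ := max (max (D - m - 2) (Df - 3)) 0 with hRm
  have hRm0 : 0 ≤ Rm := le_max_right _ _
  have hn2 : 2 ≤ (ℓ + 1) ^ k := two_le_pow hℓ hk
  have hnr : (0 : ℝ) < (((ℓ + 1) ^ k : ℕ) : ℝ) := by exact_mod_cast hn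
  have hΦ0 : 0 ≤ |CK| * Real.exp (-(Rm / K)) * φ := by positivity
  by_cases hqi : inSub ℓ k Mb Ms o q.1
  swap
  · rw [extV_of_not_inSub ℓ k Mb Ms o _ hqi, abs_zero]
    exact ⟨hΦ0, fun _ => rfl, fun h => absurd rfl h⟩
  obtain ⟨a', ha'⟩ := (inSub_iff ℓ k Mb Ms o ho _).mp hqi
  have hq' : q = (subEmb ℓ k Mb Ms o ho a', q.2) := Prod.ext ha'.symm rfl
  rw [hq', extV_subEmb]
  simp only [annPiece]
  by_cases hma : mIdx ℓ k Ms x a' = m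
  swap
  · rw [if_neg hma, abs_zero]
    exact ⟨hΦ0, fun _ => rfl, fun h => absurd rfl h⟩
  rw [if_pos hma]
  refine ⟨?_, ?_, fun _ => ⟨a', rfl, hma⟩⟩
  · -- size
    by_cases hg0 : g (a', q.2) = 0
    · rw [hg0, abs_zero]; exact hΦ0
    rw [hg] at hg0
    obtain ⟨y, hy, hdy⟩ := exists_out_of_kOp_ne_zero ℓ k Mb Ms o F κ ho hn hn2 hMs
      (B1.aSeq a ((ℓ : ℝ) + 1) k) m2 (fun u v : ↥(Box d ℓ k Ms) => compField Ac' u.1 v.1) u a' q.2 hg0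
    have hxa := lt_mIdx_add_one_mul ℓ k Ms x a'
    rw [hma] at hxa
    have hfar : ∀ a'' : ↥(Box d ℓ k Ms), supNorm (a'.1 - a''.1) ≤ (((ℓ + 1) ^ k : ℕ) : ℝ) →
        ∀ x', P x' → Rm * (((ℓ + 1) ^ k : ℕ) : ℝ) ≤ supNorm (a''.1 - x'.1) := by
      intro a'' ha'' x' hx'
      refine max3_mul_le hnr.le ?_ ?_ (supNorm_nonneg _)
      · have t1 := supNorm_sub_le_sub_add_sub x.1 a'.1 x'.1
        have t2 := supNorm_sub_le_sub_add_sub a'.1 a''.1 x'.1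
        have := hDx x' hx'
        have e1' : ((m : ℝ) + 1) * (((ℓ + 1) ^ k : ℕ) : ℝ) = (m : ℝ) * (((ℓ + 1) ^ k : ℕ) : ℝ)
            + (((ℓ + 1) ^ k : ℕ) : ℝ) := by ring
        rw [e1'] at hxa
        rw [show (D - (m : ℝ) - 2) * (((ℓ + 1) ^ k : ℕ) : ℝ) = D * (((ℓ + 1) ^ k : ℕ) : ℝ)
            - (m : ℝ) * (((ℓ + 1) ^ k : ℕ) : ℝ) - 2 * (((ℓ + 1) ^ k : ℕ) : ℝ) by ring]
        linarith only [t1, t2, this, hxa, ha'']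
      · have t1 := supNorm_sub_le_sub_add_sub (subEmb ℓ k Mb Ms o ho x').1 (subEmb ℓ k Mb Ms o ho a'').1 y.1
        have t2 := supNorm_sub_le_sub_add_sub (subEmb ℓ k Mb Ms o ho a'').1 (subEmb ℓ k Mb Ms o ho a').1 y.1
        rw [supNorm_subEmb_sub_subEmb] at t1 t2
        rw [supNorm_sub_comm x'.1] at t1
        rw [supNorm_sub_comm a''.1] at t2
        have := hDfx x' hx' y hy
        rw [sub_mul]
        linarith only [t1, t2, this, hdy, ha'']
    have hu' : ∀ a'' : ↥(Box d ℓ k Ms), supNorm (a'.1 - a''.1) ≤ (((ℓ + 1) ^ k : ℕ) : ℝ) → ∀ j,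
        |u (a'', j)| ≤ cv * Real.exp (-(Rm / K)) * φ :=
      fun a'' ha'' j => hval a'' Rm hRm0 (hfar a'' ha'') j
    have hDu' : ∀ a'' : ↥(Box d ℓ k Ms), supNorm (a'.1 - a''.1) ≤ (((ℓ + 1) ^ k : ℕ) : ℝ) → ∀ μ,
        a''.1 + e1 μ ∈ Box d ℓ k Ms → ∀ j,
        |(derivA d F κ ℓ k Ms (fun u v : ↥(Box d ℓ k Ms) => compField Ac' u.1 v.1) μ *ᵥ u) (a'', j)|
          ≤ cd * Real.exp (-(Rm / K)) * φ :=
      fun a'' ha'' μ hμ j => hder a'' μ hμ Rm hRm0 (hfar a'' ha'') j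
    have hkey := kOp_chi_apply_le ℓ k Mb Ms o F κ hℓ hk hn hMs ha h1 h2 m2 Ac' u a'
      (by positivity) (by positivity) hu' hDu' q.2
    rw [hg]
    refine hkey.trans ?_
    have hE0 : 0 ≤ Real.exp (-(Rm / K)) * φ := by positivity
    have : Real.sqrt (Fintype.card ι) * (16 * ((d : ℝ) + 1) * (cd * Real.exp (-(Rm / K)) * φ)
        + (64 * ((d : ℝ) + 1) + 2 * aplus) * (cv * Real.exp (-(Rm / K)) * φ))
        = CK * (Real.exp (-(Rm / K)) * φ) := by simp only [hCK]; ring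
    rw [this]
    calc CK * (Real.exp (-(Rm / K)) * φ) ≤ |CK| * (Real.exp (-(Rm / K)) * φ) :=
          mul_le_mul_of_nonneg_right (le_abs_self CK) hE0
      _ = |CK| * Real.exp (-(Rm / K)) * φ := by ring
  · -- vanishing for `m + 3 ≤ D_b`
    intro hsmall
    by_contra hg0
    rw [hg] at hg0
    obtain ⟨y, hy, hdy⟩ := exists_out_of_kOp_ne_zero ℓ k Mb Ms o F κ ho hn hn2 hMs
      (B1.aSeq a ((ℓ : ℝ) + 1) k) m2 (fun u v : ↥(Box d ℓ k Ms) => compField Ac' u.1 v.1) u a' q.2 hg0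
    have t1 := supNorm_sub_le_sub_add_sub (subEmb ℓ k Mb Ms o ho x).1 (subEmb ℓ k Mb Ms o ho a').1 y.1
    rw [supNorm_subEmb_sub_subEmb] at t1
    have h1' := hDbx y hy
    have h2' := lt_mIdx_add_one_mul ℓ k Ms x a'
    rw [hma] at h2'
    have h3 := mul_le_mul_of_nonneg_right hsmall hnr.le
    have e1' : ((m : ℝ) + 1) * (((ℓ + 1) ^ k : ℕ) : ℝ) = (m : ℝ) * (((ℓ + 1) ^ k : ℕ) : ℝ)
        + (((ℓ + 1) ^ k : ℕ) : ℝ) := by ring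
    have e2' : ((m : ℝ) + 3) * (((ℓ + 1) ^ k : ℕ) : ℝ) = (m : ℝ) * (((ℓ + 1) ^ k : ℕ) : ℝ)
        + 3 * (((ℓ + 1) ^ k : ℕ) : ℝ) := by ring
    rw [e1'] at h2'
    rw [e2'] at h3
    linarith only [t1, h1', h2', h3, hdy]

omit [Fintype ι] [DecidableEq ι] in
/-- **THE ANNULAR BOUND** (the print's bookkeeping «(2M)⁻¹(dist + dist + dist) − 3», p. 579, as a geometric series in the
annulus index): for an additive functional `R` of the source obeying a row bound of rate `K⁻¹` from the point `x`
(`|R(src)| ≤ c_R·e^{−m/K}·φ′` for sources of size `≤ φ′` supported at unit-lattice sup-distance `≥ m` from `x`), and a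
source on `Ω` whose annular pieces have size `≤ C·e^{−R_m/K}·φ` with `R_m ≥ ((D − m − 2) + (D_f − 3))/2`, vanish for
`m + 3 ≤ D_b`, and live over their annulus:
`|R(Eg)| ≤ c_R·C·e^{4/K}(1 − e^{−1/(2K)})⁻¹·e^{−(D + D_b + D_f)/(2K)}·φ`.
[cite: Balaban1983RegularityDecay, p.579] -/
theorem annular_bound (ho : ∀ i, o i + Ms i ≤ Mb i) (x : ↥(Box d ℓ k Ms)) (g : ↥(Box d ℓ k Ms) × ι → ℝ)
    (R : (↥(Box d ℓ k Mb) × ι → ℝ) → ℝ)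
    (hRsum : ∀ (s : Finset ℕ) (v : ℕ → ↥(Box d ℓ k Mb) × ι → ℝ), R (∑ m ∈ s, v m) = ∑ m ∈ s, R (v m))
    {K cR C φ D Db Df : ℝ} (hK : 0 < K) (hcR : 0 ≤ cR) (hC : 0 ≤ C) (hφ : 0 ≤ φ) (Rm : ℕ → ℝ)
    (hRm : ∀ m : ℕ, ((D - m - 2) + (Df - 3)) / 2 ≤ Rm m)
    (hRrow : ∀ (Pm : ↥(Box d ℓ k Mb) → Prop) [DecidablePred Pm] (m : ℕ),
      (∀ y, Pm y → (m : ℝ) * (((ℓ + 1) ^ k : ℕ) : ℝ) ≤ supNorm ((subEmb ℓ k Mb Ms o ho x).1 - y.1)) →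
      ∀ src : ↥(Box d ℓ k Mb) × ι → ℝ, (∀ q, ¬ Pm q.1 → src q = 0) → ∀ φ' : ℝ, 0 ≤ φ' →
      (∀ q, |src q| ≤ φ') → |R src| ≤ cR * Real.exp (-((m : ℝ) / K)) * φ')
    (hsrc : ∀ (m : ℕ) (q : ↥(Box d ℓ k Mb) × ι),
      |extV ℓ k Mb Ms o (annPiece ℓ k Ms x m g) q| ≤ C * Real.exp (-(Rm m / K)) * φ ∧
      (((m : ℝ) + 3 ≤ Db) → extV ℓ k Mb Ms o (annPiece ℓ k Ms x m g) q = 0) ∧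
      (extV ℓ k Mb Ms o (annPiece ℓ k Ms x m g) q ≠ 0 → ∃ a', subEmb ℓ k Mb Ms o ho a' = q.1 ∧ mIdx ℓ k Ms x a' = m)) :
    |R (extV ℓ k Mb Ms o g)|
      ≤ cR * C * Real.exp (4 / K) / (1 - Real.exp (-(1 / (2 * K)))) * Real.exp (-((D + Db + Df) / (2 * K))) * φ := by
  classical
  set r : ℝ := Real.exp (-(1 / (2 * K))) with hr
  have hr0 : 0 ≤ r := (Real.exp_pos _).le
  have hr1 : r < 1 := Real.exp_lt_one_iff.mpr (by
    have : 0 < 1 / (2 * K) := by positivity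
    linarith only [this])
  have h1r : 0 < 1 - r := by linarith only [hr1]
  set Mtop : ℕ := (∑ i, Ms i) + 1 with hMtop
  set Φm : ℕ → ℝ := fun m => C * Real.exp (-(Rm m / K)) * φ with hΦm
  have hΦm0 : ∀ m, 0 ≤ Φm m := fun m => by positivity
  -- per annulus
  set bm : ℕ → ℝ := fun m => if (m : ℝ) + 3 ≤ Db then 0 else cR * Real.exp (-((m : ℝ) / K)) * Φm m with hbm
  have hterm : ∀ m, |R (extV ℓ k Mb Ms o (annPiece ℓ k Ms x m g))| ≤ bm m := by
    intro m
    simp only [hbm]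
    by_cases hsmall : (m : ℝ) + 3 ≤ Db
    · rw [if_pos hsmall]
      have h0 : extV ℓ k Mb Ms o (annPiece ℓ k Ms x m g) = 0 := funext fun q => (hsrc m q).2.1 hsmall
      have hR0 : R 0 = 0 := by
        have := hRsum ∅ (fun _ => 0)
        simpa using this
      rw [h0, hR0, abs_zero]
    rw [if_neg hsmall]
    set Pm : ↥(Box d ℓ k Mb) → Prop := fun y => ∃ a', subEmb ℓ k Mb Ms o ho a' = y ∧ mIdx ℓ k Ms x a' = m with hPm
    haveI hPmd : DecidablePred Pm := Classical.decPred Pm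
    have hDm : ∀ y, Pm y → (m : ℝ) * (((ℓ + 1) ^ k : ℕ) : ℝ) ≤ supNorm ((subEmb ℓ k Mb Ms o ho x).1 - y.1) := by
      rintro y ⟨a', rfl, hma⟩
      rw [supNorm_subEmb_sub_subEmb, ← hma]
      exact mIdx_mul_le ℓ k Ms x a'
    have hsupp : ∀ q : ↥(Box d ℓ k Mb) × ι, ¬ Pm q.1 → extV ℓ k Mb Ms o (annPiece ℓ k Ms x m g) q = 0 := by
      intro q hq
      by_contra h0
      exact hq ((hsrc m q).2.2 h0)
    exact hRrow Pm m hDm _ hsupp (Φm m) (hΦm0 m) (fun q => (hsrc m q).1)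
  -- the geometric series
  set m₀ : ℕ := ⌈Db - 3⌉₊ with hm₀
  have hbm_le : ∀ m, bm m ≤ cR * C * φ * Real.exp (-((D + Df - 5) / (2 * K))) * (if m₀ ≤ m then r ^ m else 0) := by
    intro m
    simp only [hbm]
    by_cases hsmall : (m : ℝ) + 3 ≤ Db
    · rw [if_pos hsmall]
      split_ifs <;> positivity
    rw [if_neg hsmall]
    have hm0m : m₀ ≤ m := by
      rw [hm₀]
      exact Nat.ceil_le.mpr (by push Not at hsmall; linarith only [hsmall])
    rw [if_pos hm0m]
    have hrm : r ^ m = Real.exp (-((m : ℝ) / (2 * K))) := by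
      rw [hr, ← Real.exp_nat_mul]; congr 1; ring
    rw [hrm]
    have hexp : Real.exp (-((m : ℝ) / K)) * Real.exp (-(Rm m / K))
        ≤ Real.exp (-((D + Df - 5) / (2 * K))) * Real.exp (-((m : ℝ) / (2 * K))) := by
      rw [← Real.exp_add, ← Real.exp_add, Real.exp_le_exp]
      have hR := hRm m
      rw [show -((m : ℝ) / K) + -(Rm m / K) = (-(m + Rm m)) / K by ring,
        show -((D + Df - 5) / (2 * K)) + -((m : ℝ) / (2 * K)) = (-((D + Df - 5) / 2 + m / 2)) / K by
          field_simp; ring]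
      exact div_le_div_of_nonneg_right (by linarith only [hR]) hK.le
    calc cR * Real.exp (-((m : ℝ) / K)) * (C * Real.exp (-(Rm m / K)) * φ)
        = cR * C * φ * (Real.exp (-((m : ℝ) / K)) * Real.exp (-(Rm m / K))) := by ring
      _ ≤ cR * C * φ * (Real.exp (-((D + Df - 5) / (2 * K))) * Real.exp (-((m : ℝ) / (2 * K)))) :=
          mul_le_mul_of_nonneg_left hexp (by positivity)
      _ = cR * C * φ * Real.exp (-((D + Df - 5) / (2 * K))) * Real.exp (-((m : ℝ) / (2 * K))) := by ring
  have hgeom : ∑ m ∈ Finset.range Mtop, (if m₀ ≤ m then r ^ m else 0) ≤ r ^ m₀ / (1 - r) := by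
    rw [← Finset.sum_filter]
    have hsub : (Finset.range Mtop).filter (fun m => m₀ ≤ m) ⊆ Finset.Ico m₀ Mtop := by
      intro m hm
      rw [Finset.mem_filter, Finset.mem_range] at hm
      exact Finset.mem_Ico.mpr ⟨hm.2, hm.1⟩
    refine (Finset.sum_le_sum_of_subset_of_nonneg hsub fun m _ _ => pow_nonneg hr0 m).trans ?_
    exact geom_sum_Ico_le_of_lt_one hr0 hr1
  have hrm₀ : r ^ m₀ ≤ Real.exp (-((Db - 3) / (2 * K))) := by
    rw [hr, ← Real.exp_nat_mul, Real.exp_le_exp]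
    have : Db - 3 ≤ (m₀ : ℝ) := Nat.le_ceil _
    rw [show ((m₀ : ℕ) : ℝ) * -(1 / (2 * K)) = (-(m₀ : ℝ)) / (2 * K) by ring,
      show -((Db - 3) / (2 * K)) = (-(Db - 3)) / (2 * K) by ring]
    exact div_le_div_of_nonneg_right (by linarith only [this]) (by positivity)
  -- assemble
  rw [extV_eq_sum_annPiece ℓ k Mb Ms o x g, hRsum]
  refine (Finset.abs_sum_le_sum_abs _ _).trans ?_
  calc ∑ m ∈ Finset.range Mtop, |R (extV ℓ k Mb Ms o (annPiece ℓ k Ms x m g))|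
      ≤ ∑ m ∈ Finset.range Mtop, cR * C * φ * Real.exp (-((D + Df - 5) / (2 * K)))
          * (if m₀ ≤ m then r ^ m else 0) :=
        Finset.sum_le_sum fun m _ => (hterm m).trans (hbm_le m)
    _ = cR * C * φ * Real.exp (-((D + Df - 5) / (2 * K)))
          * ∑ m ∈ Finset.range Mtop, (if m₀ ≤ m then r ^ m else 0) := by rw [Finset.mul_sum]
    _ ≤ cR * C * φ * Real.exp (-((D + Df - 5) / (2 * K))) * (Real.exp (-((Db - 3) / (2 * K))) / (1 - r)) := by
        refine mul_le_mul_of_nonneg_left (hgeom.trans ?_) (by positivity)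
        exact div_le_div_of_nonneg_right hrm₀ h1r.le
    _ = cR * C * Real.exp (4 / K) / (1 - r) * Real.exp (-((D + Db + Df) / (2 * K))) * φ := by
        have : Real.exp (-((D + Df - 5) / (2 * K))) * Real.exp (-((Db - 3) / (2 * K)))
            = Real.exp (4 / K) * Real.exp (-((D + Db + Df) / (2 * K))) := by
          rw [← Real.exp_add, ← Real.exp_add]; congr 1; field_simp; ring
        calc cR * C * φ * Real.exp (-((D + Df - 5) / (2 * K))) * (Real.exp (-((Db - 3) / (2 * K))) / (1 - r))
            = cR * C * φ * (Real.exp (-((D + Df - 5) / (2 * K))) * Real.exp (-((Db - 3) / (2 * K))))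
                / (1 - r) := by ring
          _ = cR * C * Real.exp (4 / K) / (1 - r) * Real.exp (-((D + Db + Df) / (2 * K))) * φ := by
              rw [this]; ring

end Annular

/-! ## §3. The derivative member of (1.10)·(1.12) for `δG_k(Ω,Ω₀,A)` on nested boxes -/

section Main

variable {ι : Type} [Fintype ι] [DecidableEq ι]

/-- **THEOREM p. 573, THE `δG` CLAUSE (1.11)–(1.12), DERIVATIVE MEMBER, ON EVERY NESTED PAIR OF BOXES, WITH ONLY «e
SUFFICIENTLY SMALL»**.  There are `K` (`16 ≤ K`, `4 ∣ K`) and `c₁ > 0` (depending on `d`, `ℓ`, `N`, the flow and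
the windows only) such that for every `(c, β)` (`β > 0`) there is `e₁ > 0` with: for every scale `k ≥ 1`, `a ∈ [a₋,a₊]`,
`m² ∈ [0,m²₊]`, every pair of boxes `Ω = n·o + Π[0,nMs) ⊂ Ω₀ = Π[0,nMb)` with unit sides multiples of `K`, every
component field `A_c`, (1.7)-regular on `Ω₀` and constant on the `K`-collars of `Ω₀` and of `Ω`, every `0 < e ≤ e₁`
(coupling `e/n`), every bond `⟨x, x + ηe_ν⟩ ⊂ Ω`, every source `f` on `Ω` supported in `P` with `|f| ≤ φ`, and all
`D, D_b, D_f ≥ 0` below the unit-lattice sup-distances from `x` to `P`, from `x` to `Ω₀ ∖ Ω`, from `P` to `Ω₀ ∖ Ω`: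
`|(D^η_{A,ν}G_k(Ω,A|Ω)f)(x)_i − (D^η_{A,ν}G_k(Ω₀,A)Ef)(x)_i| ≤ c₁·exp(−(D + D_b + D_f)/(2K))·φ`.
[cite: Balaban1983RegularityDecay, Theorem (1.10)–(1.12) p.573; p.579] -/
theorem thm112_deriv_box_uniform (F : OrthFlow ι) {ℓ₁ : ℝ} (hℓ₁ : 0 ≤ ℓ₁)
    (hLip : ∀ t (v : ι → ℝ), ((F.U t - 1) *ᵥ v) ⬝ᵥ ((F.U t - 1) *ᵥ v) ≤ (ℓ₁ * t) ^ 2 * (v ⬝ᵥ v))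
    (d ℓ : ℕ) (hd : 1 ≤ d) (hℓ : 1 ≤ ℓ) (amin aplus m2plus : ℝ) (ha : 0 < amin) :
    ∃ K : ℕ, 16 ≤ K ∧ 4 ∣ K ∧ ∃ c₁ : ℝ, 0 < c₁ ∧ ∀ (creg β : ℝ), 0 ≤ creg → 0 < β →
      ∃ e₁ : ℝ, 0 < e₁ ∧ ∀ (k : ℕ), 1 ≤ k → ∀ (hn : 1 ≤ (ℓ + 1) ^ k) (a m2 : ℝ),
      amin ≤ a → a ≤ aplus → 0 ≤ m2 → m2 ≤ m2plus →
      ∀ (Mb Ms o : Fin (d + 1) → ℕ) (ho : ∀ i, o i + Ms i ≤ Mb i), (∀ i, 1 ≤ Ms i) → (∀ μ, K ∣ Mb μ) →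
        (∀ μ, K ∣ Ms μ) →
      ∀ (Ac : (Fin (d + 1) → ℤ) → Fin (d + 1) → ℝ) (e : ℝ), 0 < e → e ≤ e₁ →
        (∀ x ∈ Box d ℓ k Mb, ∀ μ ν : Fin (d + 1),
          |Ac (x + e1 μ) ν - Ac x ν| ≤ creg * e ^ (β - 1) / ((ℓ + 1) ^ k : ℕ)) →
        (∀ w ∈ Box d ℓ k Mb, (∃ μ, w μ < (((ℓ + 1) ^ k : ℕ) : ℤ) * K ∨
            (((ℓ + 1) ^ k : ℕ) : ℤ) * Mb μ < w μ + (((ℓ + 1) ^ k : ℕ) : ℤ) * K) → ∀ ν, Ac w ν = Ac 0 ν) →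
        (∀ w ∈ Box d ℓ k Ms, (∃ μ, w μ < (((ℓ + 1) ^ k : ℕ) : ℤ) * K ∨
            (((ℓ + 1) ^ k : ℕ) : ℤ) * Ms μ < w μ + (((ℓ + 1) ^ k : ℕ) : ℤ) * K) →
          ∀ ν, Ac (w + fun i => (((ℓ + 1) ^ k : ℕ) : ℤ) * (o i : ℤ)) ν
            = Ac (fun i => (((ℓ + 1) ^ k : ℕ) : ℤ) * (o i : ℤ)) ν) →
      ∀ (ν : Fin (d + 1)) (x : ↥(Box d ℓ k Ms)), x.1 + e1 ν ∈ Box d ℓ k Ms →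
      ∀ (P : ↥(Box d ℓ k Ms) → Prop) [DecidablePred P] (D Db Df : ℝ),
        0 ≤ D → 0 ≤ Db → 0 ≤ Df →
        (∀ x', P x' → ∃ μ, D ≤ |posR ℓ k Ms x μ - posR ℓ k Ms x' μ|) →
        (∀ y : ↥(Box d ℓ k Mb), ¬ inSub ℓ k Mb Ms o y →
          ∃ μ, Db ≤ |posR ℓ k Mb (subEmb ℓ k Mb Ms o ho x) μ - posR ℓ k Mb y μ|) →
        (∀ x', P x' → ∀ y : ↥(Box d ℓ k Mb), ¬ inSub ℓ k Mb Ms o y →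
          ∃ μ, Df ≤ |posR ℓ k Mb (subEmb ℓ k Mb Ms o ho x') μ - posR ℓ k Mb y μ|) →
      ∀ (f : ↥(Box d ℓ k Ms) × ι → ℝ), (∀ p, ¬ P p.1 → f p = 0) → ∀ (φ : ℝ), 0 ≤ φ → (∀ p, |f p| ≤ φ) →
      ∀ i : ι,
        |(derivA d F (e / ((ℓ + 1) ^ k : ℕ)) ℓ k Ms
              (fun u v : ↥(Box d ℓ k Ms) =>
                compField (fun w => Ac (w + fun i => (((ℓ + 1) ^ k : ℕ) : ℤ) * (o i : ℤ))) u.1 v.1) ν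
            *ᵥ (greenA d F (e / ((ℓ + 1) ^ k : ℕ)) ℓ k a m2 Ms (baseEmb hn Ms) (stairContour hn Ms)
              (fun u v : ↥(Box d ℓ k Ms) =>
                compField (fun w => Ac (w + fun i => (((ℓ + 1) ^ k : ℕ) : ℤ) * (o i : ℤ))) u.1 v.1) *ᵥ f)) (x, i)
          - (derivA d F (e / ((ℓ + 1) ^ k : ℕ)) ℓ k Mb (fun u v : ↥(Box d ℓ k Mb) => compField Ac u.1 v.1) ν
            *ᵥ (greenA d F (e / ((ℓ + 1) ^ k : ℕ)) ℓ k a m2 Mb (baseEmb hn Mb) (stairContour hn Mb)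
              (fun u v : ↥(Box d ℓ k Mb) => compField Ac u.1 v.1) *ᵥ extV ℓ k Mb Ms o f))
              (subEmb ℓ k Mb Ms o ho x, i)|
          ≤ c₁ * Real.exp (-((D + Db + Df) / (2 * K))) * φ := by
  classical
  obtain ⟨Kv, hKv8, h4v, cv, hcv, HV⟩ := thm110_value_box_uniform F hℓ₁ hLip d ℓ hd hℓ amin aplus m2plus ha
  obtain ⟨Kd, hKd8, -, cd, hcd, HD⟩ := thm110_deriv_box_uniform F hℓ₁ hLip d ℓ hd hℓ amin aplus m2plus ha
  set K : ℕ := Kv * Kd with hK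
  have hKvK : Kv ≤ K := by rw [hK]; nlinarith
  have hKdK : Kd ≤ K := by rw [hK]; nlinarith
  have hK16 : 16 ≤ K := by rw [hK]; nlinarith
  have h4 : 4 ∣ K := dvd_mul_of_dvd_left h4v Kd
  have hKvr : (0 : ℝ) < Kv := by exact_mod_cast lt_of_lt_of_le (by norm_num) hKv8
  have hKdr : (0 : ℝ) < Kd := by exact_mod_cast lt_of_lt_of_le (by norm_num) hKd8
  have hKr : (0 : ℝ) < K := by exact_mod_cast lt_of_lt_of_le (by norm_num) hK16
  have hKvKr : (Kv : ℝ) ≤ K := by exact_mod_cast hKvK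
  have hKdKr : (Kd : ℝ) ≤ K := by exact_mod_cast hKdK
  have hmonoV : ∀ {D' : ℝ}, 0 ≤ D' → Real.exp (-(D' / Kv)) ≤ Real.exp (-(D' / K)) := fun hD' =>
    Real.exp_le_exp.mpr (neg_le_neg (div_le_div_of_nonneg_left hD' hKvr hKvKr))
  have hmonoD : ∀ {D' : ℝ}, 0 ≤ D' → Real.exp (-(D' / Kd)) ≤ Real.exp (-(D' / K)) := fun hD' =>
    Real.exp_le_exp.mpr (neg_le_neg (div_le_div_of_nonneg_left hD' hKdr hKdKr))
  -- the constants
  set CK : ℝ := |Real.sqrt (Fintype.card ι) * (16 * ((d : ℝ) + 1) * cd + (64 * ((d : ℝ) + 1) + 2 * aplus) * cv)|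
    with hCK
  have hCK0 : 0 ≤ CK := abs_nonneg _
  set r : ℝ := Real.exp (-(1 / (2 * K))) with hr
  have hr1 : r < 1 := Real.exp_lt_one_iff.mpr (by
    have : 0 < 1 / (2 * (K : ℝ)) := by positivity
    linarith only [this])
  have h1r : 0 < 1 - r := by linarith only [hr1]
  set c₁ : ℝ := (cd + 8 * cv) * Real.exp (2 / K) + cd * Real.exp (1 / K) + cd * CK * Real.exp (4 / K) / (1 - r) + 1
    with hc₁
  have hc₁0 : 0 < c₁ := by positivity
  refine ⟨K, hK16, h4, c₁, hc₁0, fun creg β hcreg hβ => ?_⟩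
  obtain ⟨ev, hev, HV'⟩ := HV creg β hcreg hβ
  obtain ⟨ed, hed, HD'⟩ := HD creg β hcreg hβ
  refine ⟨min ev ed, lt_min hev hed, ?_⟩
  intro k hk hn a m2 ha1 ha2 hm1 hm2 Mb Ms o ho hMs hKMb hKMs Ac e he hle h17 hcol0 hcolΩ ν x hxν P _ D Db Df hD0 hDb0
    hDf0 hD hDb hDf f hfP φ hφ hf i
  -- scale facts
  have hn2 : 2 ≤ (ℓ + 1) ^ k := two_le_pow hℓ hk
  have hnr : (0 : ℝ) < (((ℓ + 1) ^ k : ℕ) : ℝ) := by exact_mod_cast hn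
  have hnr1 : (1 : ℝ) ≤ (((ℓ + 1) ^ k : ℕ) : ℝ) := by exact_mod_cast hn
  have hMb : ∀ i, 1 ≤ Mb i := fun i => le_trans (le_trans (hMs i) (Nat.le_add_left _ _)) (ho i)
  have ha' : 0 < a := lt_of_lt_of_le ha ha1
  have hlev : e ≤ ev := hle.trans (min_le_left _ _)
  have hled : e ≤ ed := hle.trans (min_le_right _ _)
  have hKvMb : ∀ μ, Kv ∣ Mb μ := fun μ => (Dvd.intro Kd rfl).trans (hKMb μ)
  have hKdMb : ∀ μ, Kd ∣ Mb μ := fun μ => (Dvd.intro_left Kv rfl).trans (hKMb μ)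
  have hKvMs : ∀ μ, Kv ∣ Ms μ := fun μ => (Dvd.intro Kd rfl).trans (hKMs μ)
  have hKdMs : ∀ μ, Kd ∣ Ms μ := fun μ => (Dvd.intro_left Kv rfl).trans (hKMs μ)
  -- the translated component field of `Ω`
  set t : Fin (d + 1) → ℤ := fun i => (((ℓ + 1) ^ k : ℕ) : ℤ) * (o i : ℤ) with ht
  set Ac' : (Fin (d + 1) → ℤ) → Fin (d + 1) → ℝ := fun w => Ac (w + t) with hAc'
  have hsubF : subField ℓ k Mb Ms o ho (fun u v : ↥(Box d ℓ k Mb) => compField Ac u.1 v.1)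
      = fun u v : ↥(Box d ℓ k Ms) => compField Ac' u.1 v.1 := by
    funext a' b'
    show compField Ac (subEmb ℓ k Mb Ms o ho a').1 (subEmb ℓ k Mb Ms o ho b').1 = compField Ac' a'.1 b'.1
    have h1 : (subEmb ℓ k Mb Ms o ho a').1 = a'.1 + t := by funext j; simp [subEmb, ht]
    have h2 : (subEmb ℓ k Mb Ms o ho b').1 = b'.1 + t := by funext j; simp [subEmb, ht]
    rw [h1, h2, compField_add]
  have hmemT : ∀ w ∈ Box d ℓ k Ms, w + t ∈ Box d ℓ k Mb := fun w hw =>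
    B4SubBoxCarrier.shift_mem_Box ℓ k Mb Ms o ho ⟨w, hw⟩
  have h17' : ∀ w ∈ Box d ℓ k Ms, ∀ μ ν : Fin (d + 1),
      |Ac' (w + e1 μ) ν - Ac' w ν| ≤ creg * e ^ (β - 1) / ((ℓ + 1) ^ k : ℕ) := by
    intro w hw μ ν
    have := h17 (w + t) (hmemT w hw) μ ν
    simp only [hAc']
    rw [add_right_comm]
    exact this
  have hcolW : ∀ K' : ℕ, K' ≤ K → ∀ (M : Fin (d + 1) → ℕ) (w : Fin (d + 1) → ℤ),
      (∃ μ, w μ < (((ℓ + 1) ^ k : ℕ) : ℤ) * K' ∨ (((ℓ + 1) ^ k : ℕ) : ℤ) * M μ < w μ + (((ℓ + 1) ^ k : ℕ) : ℤ) * K') →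
      (∃ μ, w μ < (((ℓ + 1) ^ k : ℕ) : ℤ) * K ∨ (((ℓ + 1) ^ k : ℕ) : ℤ) * M μ < w μ + (((ℓ + 1) ^ k : ℕ) : ℤ) * K) := by
    intro K' hK' M w hex
    have hKK : (((ℓ + 1) ^ k : ℕ) : ℤ) * K' ≤ (((ℓ + 1) ^ k : ℕ) : ℤ) * K :=
      mul_le_mul_of_nonneg_left (by exact_mod_cast hK') (by positivity)
    obtain ⟨μ, hμ | hμ⟩ := hex
    · exact ⟨μ, Or.inl (lt_of_lt_of_le hμ hKK)⟩
    · exact ⟨μ, Or.inr (by linarith only [hμ, hKK])⟩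
  have hcol0' : ∀ K' : ℕ, K' ≤ K → ∀ w ∈ Box d ℓ k Mb, (∃ μ, w μ < (((ℓ + 1) ^ k : ℕ) : ℤ) * K' ∨
      (((ℓ + 1) ^ k : ℕ) : ℤ) * Mb μ < w μ + (((ℓ + 1) ^ k : ℕ) : ℤ) * K') → ∀ ν, Ac w ν = Ac 0 ν :=
    fun K' hK' w hw hex => hcol0 w hw (hcolW K' hK' Mb w hex)
  have hcolΩ' : ∀ K' : ℕ, K' ≤ K → ∀ w ∈ Box d ℓ k Ms, (∃ μ, w μ < (((ℓ + 1) ^ k : ℕ) : ℤ) * K' ∨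
      (((ℓ + 1) ^ k : ℕ) : ℤ) * Ms μ < w μ + (((ℓ + 1) ^ k : ℕ) : ℤ) * K') → ∀ ν, Ac' w ν = Ac' 0 ν := by
    intro K' hK' w hw hex ν
    simp only [hAc']
    rw [zero_add]
    exact hcolΩ w hw (hcolW K' hK' Ms w hex) ν
  -- the members of (1.10) on `Ω` and `Ω₀`
  have VΩ := HV' k hk hn a m2 ha1 ha2 hm1 hm2 Ms hMs hKvMs Ac' e he hlev h17' (hcolΩ' Kv hKvK)
  have DΩ := HD' k hk hn a m2 ha1 ha2 hm1 hm2 Ms hMs hKdMs Ac' e he hled h17' (hcolΩ' Kd hKdK)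
  have DΩ₀ := HD' k hk hn a m2 ha1 ha2 hm1 hm2 Mb hMb hKdMb Ac e he hled h17 (hcol0' Kd hKdK)
  -- the cutoff and the decomposition
  set χv : ↥(Box d ℓ k Ms) → ℝ := fun z => chi ((ℓ + 1) ^ k) Ms Mb (fun i => (o i : ℤ)) z.1 with hχv
  have hχL : ∀ z, Layer ℓ k Mb Ms o ho z → χv z = 0 := fun z hz => chi_eq_zero_of_layer ℓ k Mb Ms o ho hn z hz
  have hχ01 : ∀ z, 0 ≤ χv z ∧ χv z ≤ 1 := fun z =>
    ⟨B4Delta112ZeroBox.chi_nonneg _ _ _ _ _, B4Delta112ZeroBox.chi_le_one _ _ _ _ _⟩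
  have hsz := hsize_chi ℓ k Mb Ms o hn2 hMs
  have hdec := deltaG_decomp_fun ℓ k Mb Ms o F (e / ((ℓ + 1) ^ k : ℕ)) ho hℓ hk hn ha' hm1
    (fun u v : ↥(Box d ℓ k Mb) => compField Ac u.1 v.1) χv hχL f
  rw [hsubF] at hdec
  -- abbreviations
  set GΩ := greenA d F (e / ((ℓ + 1) ^ k : ℕ)) ℓ k a m2 Ms (baseEmb hn Ms) (stairContour hn Ms)
    (fun u v : ↥(Box d ℓ k Ms) => compField Ac' u.1 v.1) with hGΩ
  set G₀ := greenA d F (e / ((ℓ + 1) ^ k : ℕ)) ℓ k a m2 Mb (baseEmb hn Mb) (stairContour hn Mb)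
    (fun u v : ↥(Box d ℓ k Mb) => compField Ac u.1 v.1) with hG₀
  set DνΩ := derivA d F (e / ((ℓ + 1) ^ k : ℕ)) ℓ k Ms (fun u v : ↥(Box d ℓ k Ms) => compField Ac' u.1 v.1) ν
    with hDνΩ
  set Dν₀ := derivA d F (e / ((ℓ + 1) ^ k : ℕ)) ℓ k Mb (fun u v : ↥(Box d ℓ k Mb) => compField Ac u.1 v.1) ν
    with hDν₀
  set u := GΩ *ᵥ f with hu
  set g := kOp F (e / ((ℓ + 1) ^ k : ℕ)) ((ℓ + 1) ^ k) (B1.aSeq a ((ℓ : ℝ) + 1) k) m2 Ms (baseEmb hn Ms)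
    (stairContour hn Ms) (fun u v : ↥(Box d ℓ k Ms) => compField Ac' u.1 v.1) χv *ᵥ u with hg
  set f₃ := mulH (ι := ι) (fun z => 1 - χv z) *ᵥ f with hf₃
  set FF : ℝ := Real.exp (-((D + Db + Df) / (2 * K))) with hFF
  have hFF0 : 0 < FF := Real.exp_pos _
  -- rewrite the left-hand side through the decomposition and `derivA_restrV_apply`
  have hrestr : ∀ w : ↥(Box d ℓ k Mb) × ι → ℝ,
      (DνΩ *ᵥ restrV ℓ k Mb Ms o ho w) (x, i) = (Dν₀ *ᵥ w) (subEmb ℓ k Mb Ms o ho x, i) := by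
    intro w
    have := derivA_restrV_apply ℓ k Mb Ms o F (e / ((ℓ + 1) ^ k : ℕ)) ho
      (fun u v : ↥(Box d ℓ k Mb) => compField Ac u.1 v.1) w ν x hxν i
    rw [hsubF] at this
    exact this
  have hLHS : (DνΩ *ᵥ u) (x, i) - (Dν₀ *ᵥ (G₀ *ᵥ extV ℓ k Mb Ms o f)) (subEmb ℓ k Mb Ms o ho x, i)
      = (DνΩ *ᵥ (mulH (ι := ι) (fun z => 1 - χv z) *ᵥ u)) (x, i)
        - (Dν₀ *ᵥ (G₀ *ᵥ extV ℓ k Mb Ms o g)) (subEmb ℓ k Mb Ms o ho x, i)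
        - (Dν₀ *ᵥ (G₀ *ᵥ extV ℓ k Mb Ms o f₃)) (subEmb ℓ k Mb Ms o ho x, i) := by
    rw [← hrestr, ← hrestr, ← hrestr]
    have := congrArg (fun w => (DνΩ *ᵥ w) (x, i)) hdec
    simp only [Matrix.mulVec_sub, Pi.sub_apply] at this
    exact this
  rw [hLHS]
  -- distance tools
  have hDx : ∀ x', P x' → D * (((ℓ + 1) ^ k : ℕ) : ℝ) ≤ supNorm (x.1 - x'.1) := fun x' hx' => by
    obtain ⟨μ, hμ⟩ := hD x' hx'; exact le_supNorm_of_coord ℓ k Ms x x' hμ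
  have hDbx : ∀ y : ↥(Box d ℓ k Mb), ¬ inSub ℓ k Mb Ms o y →
      Db * (((ℓ + 1) ^ k : ℕ) : ℝ) ≤ supNorm ((subEmb ℓ k Mb Ms o ho x).1 - y.1) := fun y hy => by
    obtain ⟨μ, hμ⟩ := hDb y hy; exact le_supNorm_of_coord ℓ k Mb _ y hμ
  have hDfx : ∀ x', P x' → ∀ y : ↥(Box d ℓ k Mb), ¬ inSub ℓ k Mb Ms o y →
      Df * (((ℓ + 1) ^ k : ℕ) : ℝ) ≤ supNorm ((subEmb ℓ k Mb Ms o ho x').1 - y.1) := fun x' hx' y hy => by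
    obtain ⟨μ, hμ⟩ := hDf x' hx' y hy; exact le_supNorm_of_coord ℓ k Mb _ y hμ
  set x' : ↥(Box d ℓ k Ms) := ⟨x.1 + e1 ν, hxν⟩ with hx'
  have hxx' : supNorm (x.1 - x'.1) ≤ 1 := supNorm_sub_le_one_of_mem_nbrs (mem_nbrs.2 ⟨ν, Or.inl rfl⟩)
  ---------------------------------------------------------------- T1'
  have hT1 : |(DνΩ *ᵥ (mulH (ι := ι) (fun z => 1 - χv z) *ᵥ u)) (x, i)| ≤ (cd + 8 * cv) * Real.exp (2 / K) * FF * φ := by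
    rw [hDνΩ, derivA_mulH_apply ℓ k F (e / ((ℓ + 1) ^ k : ℕ)) Ms _ (fun z => 1 - χv z) u ν x hxν i]
    -- a point of `Ω₀ ∖ Ω` within `2n` of `x`, when one of the two cutoff values is not `1`
    have hnear : χv x ≠ 1 ∨ χv x' ≠ 1 → ∃ y : ↥(Box d ℓ k Mb), ¬ inSub ℓ k Mb Ms o y ∧
        supNorm ((subEmb ℓ k Mb Ms o ho x).1 - y.1) ≤ 2 * (((ℓ + 1) ^ k : ℕ) : ℝ) := by
      rintro (h | h)
      · obtain ⟨y, hy, hd'⟩ := exists_out_of_chi_ne_one ℓ k Mb Ms o ho hn2 hMs x h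
        exact ⟨y, hy, by linarith only [hd', hnr.le]⟩
      · obtain ⟨y, hy, hd'⟩ := exists_out_of_chi_ne_one ℓ k Mb Ms o ho hn2 hMs x' h
        refine ⟨y, hy, ?_⟩
        have t1 := supNorm_sub_le_sub_add_sub (subEmb ℓ k Mb Ms o ho x).1 (subEmb ℓ k Mb Ms o ho x').1 y.1
        rw [supNorm_subEmb_sub_subEmb] at t1
        linarith only [t1, hd', hxx', hnr1]
    -- the common distance bookkeeping
    have hbook : (∃ y : ↥(Box d ℓ k Mb), ¬ inSub ℓ k Mb Ms o y ∧
        supNorm ((subEmb ℓ k Mb Ms o ho x).1 - y.1) ≤ 2 * (((ℓ + 1) ^ k : ℕ) : ℝ)) →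
        Db ≤ 2 ∧ ∀ x'', P x'' → max ((D + (Df - 2)) / 2) 0 * (((ℓ + 1) ^ k : ℕ) : ℝ) ≤ supNorm (x.1 - x''.1) := by
      rintro ⟨y, hy, hdy⟩
      refine ⟨?_, fun x'' hx'' => max_half_mul_le hnr.le (hDx x'' hx'') ?_ (supNorm_nonneg _)⟩
      · have := (hDbx y hy).trans hdy
        exact le_of_mul_le_mul_right (by linarith only [this]) hnr
      · have t1 := supNorm_sub_le_sub_add_sub (subEmb ℓ k Mb Ms o ho x'').1 (subEmb ℓ k Mb Ms o ho x).1 y.1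
        rw [supNorm_subEmb_sub_subEmb, supNorm_sub_comm x''.1] at t1
        have := hDfx x'' hx'' y hy
        rw [sub_mul]
        linarith only [t1, this, hdy]
    set D₁ : ℝ := max ((D + (Df - 2)) / 2) 0 with hD₁
    have hD₁0 : 0 ≤ D₁ := le_max_right _ _
    -- first term
    have hA : |(1 - χv x') * (DνΩ *ᵥ u) (x, i)| ≤ cd * Real.exp (2 / K) * FF * φ := by
      by_cases h1 : χv x' = 1
      · rw [h1, sub_self, zero_mul, abs_zero]; positivity
      obtain ⟨hDb2, hfarP⟩ := hbook (hnear (Or.inr h1))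
      have hD₁P : ∀ x'', P x'' → ∃ μ, D₁ ≤ |posR ℓ k Ms x μ - posR ℓ k Ms x'' μ| :=
        fun x'' hx'' => exists_coord_of_le_supNorm ℓ k Ms x x'' (hfarP x'' hx'')
      have hDu := DΩ ν x hxν P D₁ hD₁P f hfP φ hφ hf i
      have hexp : Real.exp (-(D₁ / Kd)) ≤ Real.exp (2 / K) * FF :=
        (hmonoD hD₁0).trans (exp_bookkeeping hKr (by
          have : (D + (Df - 2)) / 2 ≤ D₁ := le_max_left _ _
          linarith only [this, hDb2]))
      obtain ⟨h0, h1'⟩ := hχ01 x'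
      rw [abs_mul]
      calc |1 - χv x'| * |(DνΩ *ᵥ u) (x, i)| ≤ 1 * (cd * Real.exp (-(D₁ / Kd)) * φ) :=
            mul_le_mul (by rw [abs_of_nonneg (by linarith only [h1'])]; linarith only [h0]) hDu (abs_nonneg _)
              zero_le_one
        _ ≤ cd * (Real.exp (2 / K) * FF) * φ := by
            rw [one_mul]; exact mul_le_mul_of_nonneg_right (mul_le_mul_of_nonneg_left hexp hcd.le) hφ
        _ = cd * Real.exp (2 / K) * FF * φ := by ring
    -- second term
    have hB : |(((ℓ + 1) ^ k : ℕ) : ℝ) * ((1 - χv x') - (1 - χv x)) * u (x, i)|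
        ≤ 8 * cv * Real.exp (2 / K) * FF * φ := by
      by_cases h1 : χv x = χv x'
      · rw [h1, sub_self, mul_zero, zero_mul, abs_zero]; positivity
      have hne : χv x ≠ 1 ∨ χv x' ≠ 1 := by
        by_contra hc
        push Not at hc
        exact h1 (by rw [hc.1, hc.2])
      obtain ⟨hDb2, hfarP⟩ := hbook (hnear hne)
      have hD₁P : ∀ x'', P x'' → ∃ μ, D₁ ≤ |posR ℓ k Ms x μ - posR ℓ k Ms x'' μ| :=
        fun x'' hx'' => exists_coord_of_le_supNorm ℓ k Ms x x'' (hfarP x'' hx'')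
      have hux := VΩ x P D₁ hD₁P f hfP φ hφ hf i
      have hexp : Real.exp (-(D₁ / Kv)) ≤ Real.exp (2 / K) * FF :=
        (hmonoV hD₁0).trans (exp_bookkeeping hKr (by
          have : (D + (Df - 2)) / 2 ≤ D₁ := le_max_left _ _
          linarith only [this, hDb2]))
      have hgrad : |(((ℓ + 1) ^ k : ℕ) : ℝ) * ((1 - χv x') - (1 - χv x))| ≤ 8 := by
        have hmem : x' ∈ boxNbrs (fun j => (ℓ + 1) ^ k * Ms j) x := by
          unfold boxNbrs; simpa using (mem_nbrs.2 ⟨ν, Or.inl rfl⟩ : x'.1 ∈ nbrs x.1)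
        have := hsz.grad_le x x' hmem
        rw [show (1 - χv x') - (1 - χv x) = -(χv x' - χv x) by ring, mul_neg, abs_neg, abs_mul,
          abs_of_nonneg hnr.le]
        exact this
      rw [abs_mul]
      calc |(((ℓ + 1) ^ k : ℕ) : ℝ) * ((1 - χv x') - (1 - χv x))| * |u (x, i)|
          ≤ 8 * (cv * Real.exp (-(D₁ / Kv)) * φ) := mul_le_mul hgrad hux (abs_nonneg _) (by norm_num)
        _ ≤ 8 * (cv * (Real.exp (2 / K) * FF) * φ) := by
            refine mul_le_mul_of_nonneg_left ?_ (by norm_num)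
            exact mul_le_mul_of_nonneg_right (mul_le_mul_of_nonneg_left hexp hcv.le) hφ
        _ = 8 * cv * Real.exp (2 / K) * FF * φ := by ring
    refine (abs_add_le _ _).trans ?_
    have : cd * Real.exp (2 / K) * FF * φ + 8 * cv * Real.exp (2 / K) * FF * φ
        = (cd + 8 * cv) * Real.exp (2 / K) * FF * φ := by ring
    rw [← this]
    exact add_le_add hA hB
  ---------------------------------------------------------------- T3'
  have hT3 : |(Dν₀ *ᵥ (G₀ *ᵥ extV ℓ k Mb Ms o f₃)) (subEmb ℓ k Mb Ms o ho x, i)| ≤ cd * Real.exp (1 / K) * FF * φ := by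
    have hf₃v : ∀ q, f₃ q = (1 - χv q.1) * f q := fun q => mulH_mulVec_apply _ _ q
    have hxν' : (subEmb ℓ k Mb Ms o ho x).1 + e1 ν ∈ Box d ℓ k Mb := subEmb_add_e1_mem ℓ k Mb Ms o ho x ν hxν
    by_cases hP3 : ∃ a₀, P a₀ ∧ χv a₀ ≠ 1
    · obtain ⟨a₀, ha₀P, ha₀χ⟩ := hP3
      obtain ⟨y₀, hy₀, hd₀⟩ := exists_out_of_chi_ne_one ℓ k Mb Ms o ho hn2 hMs a₀ ha₀χ
      have hDf1 : Df ≤ 1 := by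
        have := (hDfx a₀ ha₀P y₀ hy₀).trans hd₀
        exact le_of_mul_le_mul_right (by linarith only [this]) hnr
      set D₃ : ℝ := max ((D + (Db - 1)) / 2) 0 with hD₃
      have hD₃0 : 0 ≤ D₃ := le_max_right _ _
      set P₃ : ↥(Box d ℓ k Mb) → Prop := fun y => ∃ a', subEmb ℓ k Mb Ms o ho a' = y ∧ P a' ∧ χv a' ≠ 1 with hP₃
      haveI hP₃d : DecidablePred P₃ := Classical.decPred P₃
      have hD₃P : ∀ y, P₃ y → ∃ μ, D₃ ≤ |posR ℓ k Mb (subEmb ℓ k Mb Ms o ho x) μ - posR ℓ k Mb y μ| := by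
        rintro y ⟨a', rfl, ha'P, ha'χ⟩
        obtain ⟨y', hy', hd'⟩ := exists_out_of_chi_ne_one ℓ k Mb Ms o ho hn2 hMs a' ha'χ
        refine exists_coord_of_le_supNorm ℓ k Mb _ _ (max_half_mul_le hnr.le ?_ ?_ (supNorm_nonneg _))
        · rw [supNorm_subEmb_sub_subEmb]; exact hDx a' ha'P
        · have t1 := supNorm_sub_le_sub_add_sub (subEmb ℓ k Mb Ms o ho x).1 (subEmb ℓ k Mb Ms o ho a').1 y'.1
          have := hDbx y' hy'
          rw [sub_mul, one_mul]
          linarith only [t1, this, hd']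
      have hsupp : ∀ q : ↥(Box d ℓ k Mb) × ι, ¬ P₃ q.1 → extV ℓ k Mb Ms o f₃ q = 0 := by
        intro q hq
        by_cases hqi : inSub ℓ k Mb Ms o q.1
        · obtain ⟨a', ha'⟩ := (inSub_iff ℓ k Mb Ms o ho _).mp hqi
          have hq' : q = (subEmb ℓ k Mb Ms o ho a', q.2) := Prod.ext ha'.symm rfl
          rw [hq', extV_subEmb, hf₃v]
          by_cases hPa : P a'
          · have hχa : χv a' = 1 := by
              by_contra hc; exact hq ⟨a', ha', hPa, hc⟩
            simp only [hχa, sub_self, zero_mul]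
          · rw [hfP (a', q.2) hPa, mul_zero]
        · exact extV_of_not_inSub ℓ k Mb Ms o f₃ hqi
      have hbd : ∀ q : ↥(Box d ℓ k Mb) × ι, |extV ℓ k Mb Ms o f₃ q| ≤ φ := by
        intro q
        by_cases hqi : inSub ℓ k Mb Ms o q.1
        · obtain ⟨a', ha'⟩ := (inSub_iff ℓ k Mb Ms o ho _).mp hqi
          have hq' : q = (subEmb ℓ k Mb Ms o ho a', q.2) := Prod.ext ha'.symm rfl
          rw [hq', extV_subEmb, hf₃v, abs_mul]
          obtain ⟨h0, h1⟩ := hχ01 a'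
          calc |1 - χv a'| * |f (a', q.2)| ≤ 1 * φ :=
                mul_le_mul (by rw [abs_of_nonneg (by linarith only [h1])]; linarith only [h0]) (hf _)
                  (abs_nonneg _) zero_le_one
            _ = φ := one_mul φ
        · rw [extV_of_not_inSub ℓ k Mb Ms o f₃ hqi, abs_zero]; exact hφ
      have h3 := DΩ₀ ν (subEmb ℓ k Mb Ms o ho x) hxν' P₃ D₃ hD₃P (extV ℓ k Mb Ms o f₃) hsupp φ hφ hbd i
      have hexp : Real.exp (-(D₃ / Kd)) ≤ Real.exp (1 / K) * FF :=
        (hmonoD hD₃0).trans (exp_bookkeeping hKr (by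
          have : (D + (Db - 1)) / 2 ≤ D₃ := le_max_left _ _
          linarith only [this, hDf1]))
      calc |(Dν₀ *ᵥ (G₀ *ᵥ extV ℓ k Mb Ms o f₃)) (subEmb ℓ k Mb Ms o ho x, i)| ≤ cd * Real.exp (-(D₃ / Kd)) * φ := h3
        _ ≤ cd * (Real.exp (1 / K) * FF) * φ :=
            mul_le_mul_of_nonneg_right (mul_le_mul_of_nonneg_left hexp hcd.le) hφ
        _ = cd * Real.exp (1 / K) * FF * φ := by ring
    · push Not at hP3
      have hf₃0 : f₃ = 0 := by
        funext q
        rw [hf₃v]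
        by_cases hPq : P q.1
        · rw [hP3 q.1 hPq, sub_self, zero_mul]; rfl
        · rw [hfP q hPq, mul_zero]; rfl
      have hE0 : extV ℓ k Mb Ms o f₃ = 0 := by
        funext q; rw [hf₃0]; simp [extV]
      rw [hE0, Matrix.mulVec_zero, Matrix.mulVec_zero, Pi.zero_apply, abs_zero]
      positivity
  ---------------------------------------------------------------- T2'
  have hT2 : |(Dν₀ *ᵥ (G₀ *ᵥ extV ℓ k Mb Ms o g)) (subEmb ℓ k Mb Ms o ho x, i)|
      ≤ cd * CK * Real.exp (4 / K) / (1 - r) * FF * φ := by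
    have hxν' : (subEmb ℓ k Mb Ms o ho x).1 + e1 ν ∈ Box d ℓ k Mb := subEmb_add_e1_mem ℓ k Mb Ms o ho x ν hxν
    -- the source facts
    have hval : ∀ (a'' : ↥(Box d ℓ k Ms)) (D' : ℝ), 0 ≤ D' →
        (∀ x'', P x'' → D' * (((ℓ + 1) ^ k : ℕ) : ℝ) ≤ supNorm (a''.1 - x''.1)) →
        ∀ j, |u (a'', j)| ≤ cv * Real.exp (-(D' / K)) * φ := by
      intro a'' D' hD'0 hD' j
      have := VΩ a'' P D' (fun x'' hx'' => exists_coord_of_le_supNorm ℓ k Ms a'' x'' (hD' x'' hx'')) f hfP φ hφ hf j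
      exact this.trans (mul_le_mul_of_nonneg_right (mul_le_mul_of_nonneg_left (hmonoV hD'0) hcv.le) hφ)
    have hder : ∀ (a'' : ↥(Box d ℓ k Ms)) (μ : Fin (d + 1)), a''.1 + e1 μ ∈ Box d ℓ k Ms → ∀ (D' : ℝ), 0 ≤ D' →
        (∀ x'', P x'' → D' * (((ℓ + 1) ^ k : ℕ) : ℝ) ≤ supNorm (a''.1 - x''.1)) →
        ∀ j, |(derivA d F (e / ((ℓ + 1) ^ k : ℕ)) ℓ k Ms (fun u v : ↥(Box d ℓ k Ms) => compField Ac' u.1 v.1) μ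
          *ᵥ u) (a'', j)| ≤ cd * Real.exp (-(D' / K)) * φ := by
      intro a'' μ hμ D' hD'0 hD' j
      have := DΩ μ a'' hμ P D' (fun x'' hx'' => exists_coord_of_le_supNorm ℓ k Ms a'' x'' (hD' x'' hx''))
        f hfP φ hφ hf j
      exact this.trans (mul_le_mul_of_nonneg_right (mul_le_mul_of_nonneg_left (hmonoD hD'0) hcd.le) hφ)
    have hsrc := source_facts ℓ k Mb Ms o F (e / ((ℓ + 1) ^ k : ℕ)) ho hℓ hk hn hMs ha ha1 ha2 m2 Ac' u x P
      hcv.le hcd.le hφ hDx hDbx hDfx hval hder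
    -- the row bound of the functional `src ↦ (D_νG₀ src)(x)`
    set R : (↥(Box d ℓ k Mb) × ι → ℝ) → ℝ := fun src => (Dν₀ *ᵥ (G₀ *ᵥ src)) (subEmb ℓ k Mb Ms o ho x, i) with hR
    have hRsum : ∀ (s : Finset ℕ) (v : ℕ → ↥(Box d ℓ k Mb) × ι → ℝ), R (∑ m ∈ s, v m) = ∑ m ∈ s, R (v m) := by
      intro s v
      simp only [hR, Matrix.mulVec_sum, Finset.sum_apply]
    have hRrow : ∀ (Pm : ↥(Box d ℓ k Mb) → Prop) [DecidablePred Pm] (m : ℕ),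
        (∀ y, Pm y → (m : ℝ) * (((ℓ + 1) ^ k : ℕ) : ℝ) ≤ supNorm ((subEmb ℓ k Mb Ms o ho x).1 - y.1)) →
        ∀ src : ↥(Box d ℓ k Mb) × ι → ℝ, (∀ q, ¬ Pm q.1 → src q = 0) → ∀ φ' : ℝ, 0 ≤ φ' →
        (∀ q, |src q| ≤ φ') → |R src| ≤ cd * Real.exp (-((m : ℝ) / K)) * φ' := by
      intro Pm _ m hPm src hsupp φ' hφ' hbd
      have := DΩ₀ ν (subEmb ℓ k Mb Ms o ho x) hxν' Pm (m : ℝ)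
        (fun y hy => exists_coord_of_le_supNorm ℓ k Mb _ y (hPm y hy)) src hsupp φ' hφ' hbd i
      exact this.trans (mul_le_mul_of_nonneg_right
        (mul_le_mul_of_nonneg_left (hmonoD (Nat.cast_nonneg m)) hcd.le) hφ')
    have hann := annular_bound ℓ k Mb Ms o ho x g R hRsum hKr hcd.le hCK0 hφ
      (fun m => max (max (D - m - 2) (Df - 3)) 0)
      (fun m => by
        show ((D - (m : ℝ) - 2) + (Df - 3)) / 2 ≤ max (max (D - (m : ℝ) - 2) (Df - 3)) 0
        have h1 : D - m - 2 ≤ max (max (D - (m : ℝ) - 2) (Df - 3)) 0 := (le_max_left _ _).trans (le_max_left _ _)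
        have h2 : Df - 3 ≤ max (max (D - (m : ℝ) - 2) (Df - 3)) 0 := (le_max_right _ _).trans (le_max_left _ _)
        linarith only [h1, h2])
      hRrow hsrc
    simpa only [hR, hr] using hann
  ---------------------------------------------------------------- total
  have hsum : |(DνΩ *ᵥ (mulH (ι := ι) (fun z => 1 - χv z) *ᵥ u)) (x, i)
      - (Dν₀ *ᵥ (G₀ *ᵥ extV ℓ k Mb Ms o g)) (subEmb ℓ k Mb Ms o ho x, i)
      - (Dν₀ *ᵥ (G₀ *ᵥ extV ℓ k Mb Ms o f₃)) (subEmb ℓ k Mb Ms o ho x, i)|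
      ≤ (cd + 8 * cv) * Real.exp (2 / K) * FF * φ + cd * CK * Real.exp (4 / K) / (1 - r) * FF * φ
        + cd * Real.exp (1 / K) * FF * φ := by
    refine (abs_sub _ _).trans (add_le_add ((abs_sub _ _).trans (add_le_add hT1 hT2)) hT3)
  refine hsum.trans ?_
  have : (cd + 8 * cv) * Real.exp (2 / K) * FF * φ + cd * CK * Real.exp (4 / K) / (1 - r) * FF * φ
      + cd * Real.exp (1 / K) * FF * φ
      = ((cd + 8 * cv) * Real.exp (2 / K) + cd * Real.exp (1 / K) + cd * CK * Real.exp (4 / K) / (1 - r)) * FF * φ := by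
    ring
  rw [this, hFF]
  refine mul_le_mul_of_nonneg_right (mul_le_mul_of_nonneg_right ?_ hFF0.le) hφ
  rw [hc₁]
  exact le_add_of_nonneg_right zero_le_one

end Main

end

end Literature.MathematicalPhysics.QuantumFieldTheory.Balaban1983to89.B4Thm112BoxDeriv
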